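import Summits.Ventures.Crystal3D.Theorems.StickyWulffConstantGenericWallFloorBarlowWindowFamily
import Summits.Ventures.Crystal3D.Theorems.StickyWulffConstantGenericWallFloorBarlowOrbitFree
import Summits.Ventures.Crystal3D.Theorems.StickyWulffConstantGenericWallFloorStackWalkInjectiveTilt
import HarnessLib

/-!
# Window families with a TILTED vertical are end-injective over an `e₃`-window (K1b / EDGE-ON option (ε), brick 2 — the critical path)
# (lane T crux `TextureLiminfV5`, stmt-Ventures-23912, sub-crux EDGE-ON `stub_edgeOn`; cf-p1 DECISION (ciii)(2); HOME/wall-p2-g11/EPSILON-SIZING.md)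

HONEST FRAMING. Venture `Summits/Ventures/Crystal3D` (cell `crystal3d-full`), route `route-Ventures-StickyWulffConstant`, helper `--supports` the
law-v5 crux `TextureLiminfV5` (stmt-Ventures-23912), registered line `TexShadow` v8.3, open stub `stub_edgeOn` (K4).  Rung credit only; F-C1 not moved; NOT
the stub.  Pure walk bookkeeping, standard axioms; E1 BY NAME (`hs₁/hcert`).

THE POINT.  `canon_orbitFree` / `windowFamily_walkRun_injOn` (…BarlowOrbitFree, …BarlowWindowFamily) make the zigzag window family of a Barlow plate
end-injective when the window is described by heights along the STEERING `z`; for a tilted steering that window is a tilted slab and does not fit inside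
the clamped plate (the same obstacle lane G met for fcc grains, solved in `…StackWalkInjectiveTilt`).  This file re-proves both with the window in
`e₃`-HEIGHTS while the walk (canonical start states, `∇`-cappers `bestCapper G (L e₃) z`, validity, orbits) runs along `z`, ‖z − e₃‖ ≤ 1/4:
* **`canon_orbitFree_tilt`** — prefixes inside the complete region (`hin`), valid starts, one start per zigzag (`hlines`), and every start strictly below every
  EXIT SITE in `e₃`-height (`hexit`) ⇒ no start lies on another's forward orbit (beyond the exit site `e₃`-heights never decrease: `walkRun_height3_mono'`);
* **`canon_walkRun_injOn_tilt`** — hence the family is end-injective (`walkRun_injOn_of_orbitFree`);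
* **`windowFamily_walkRun_injOn_tilt`** — the window-family form: in-plate steps rising `≥ δ > 0` IN `e₃` (`hδ`), complete region `R` containing every site of
  `e₃`-height in `[H, Ztop]` within `(Ztop − H)/δ + 1` of a start, starts at `e₃`-height `≥ H` with zigzag predecessors below `H`, pairwise distinct, valid.
WHAT THIS IS NOT: not the steered family's start validity / ends / count (bricks `…CanonValid` (z-general already), `…BarlowCoreAvoidTilt`, next files); F-C1 not moved.
-/

noncomputable section

namespace Summit.Ventures.Crystal3D.Theorems

open Finset
open Literature.MathematicalPhysics.StatisticalMechanics
open scoped InnerProductSpace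

variable {X : Finset (EuclideanSpace ℝ (Fin 3))}

section Moved

variable (σ : ℤ → ℤ) (L : EuclideanSpace ℝ (Fin 3) ≃ₗᵢ[ℝ] EuclideanSpace ℝ (Fin 3)) (s₀ z v₀ : EuclideanSpace ℝ (Fin 3))
  (canon : ℤ → EuclideanSpace ℝ (Fin 3) → EuclideanSpace ℝ (Fin 3) × List WalkEntry) (ms : ℤ → EuclideanSpace ℝ (Fin 3))

/-- **Orbit-freeness from the line structure, tilted vertical, exit sites above all starts in `e₃`-height.** -/
theorem canon_orbitFree_tilt (hσ : IsHaggSeq σ) (hX₁ : ∀ p ∈ X, ∀ q ∈ X, p ≠ q → 1 ≤ dist p q)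
    {s₁ : EuclideanSpace ℝ (Fin 3)} (hs₁ : s₁ ∈ fccSlots) (hcert : ExactOnly 0 (fccSlots.filter fun w => 0 < ⟪w, s₁⟫_ℝ))
    (hz : ‖z‖ = 1) (hze : ‖z - EuclideanSpace.single (2 : Fin 3) (1 : ℝ)‖ ≤ 1 / 4)
    (hv₀ : v₀ ∈ fccSlots) (hv₀2 : v₀ 2 = Real.sqrt (2 / 3))
    (hcanon₁ : ∀ m t, σ (m - 1) = 1 → canon m t = (t, [⟨L, v₀, 0⟩]))
    (hcanon₂ : ∀ m t, σ (m - 1) = -1 → canon m t =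
      (t, [⟨twinFrame L (L (EuclideanSpace.single (2 : Fin 3) (1 : ℝ))),
            bestCapper (twinFrame L (L (EuclideanSpace.single (2 : Fin 3) (1 : ℝ)))) (L (EuclideanSpace.single (2 : Fin 3) (1 : ℝ))) z,
            L (EuclideanSpace.single (2 : Fin 3) (1 : ℝ))⟩, ⟨L, v₀, 0⟩]))
    (hms₁ : ∀ m, σ m = 1 → ms m = v₀)
    (hms₂ : ∀ m, σ m = -1 → ms m =
      basalMirror (bestCapper (twinFrame L (L (EuclideanSpace.single (2 : Fin 3) (1 : ℝ)))) (L (EuclideanSpace.single (2 : Fin 3) (1 : ℝ))) z))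
    (R : Set (EuclideanSpace ℝ (Fin 3)))
    (hR : ∀ m i j : ℤ, barlowPos 1 (Real.sqrt (2 / 3)) σ m i j ∈ R →
      ∀ q ∈ barlowStacking 1 (Real.sqrt (2 / 3)) σ, dist q (barlowPos 1 (Real.sqrt (2 / 3)) σ m i j) ≤ 1 → L q + s₀ ∈ X)
    {ι : Type*} (T : Finset ι) (mi ai bi : ι → ℤ) (n : ι → ℕ)
    (hin : ∀ i ∈ T, ∀ k < n i,
      barlowPos 1 (Real.sqrt (2 / 3)) σ (mi i) (ai i) (bi i) + ∑ k' ∈ Finset.range k, ms (mi i + k') ∈ R)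
    (hvalid : ∀ i ∈ T, WalkInv X z (canon (mi i) (L (barlowPos 1 (Real.sqrt (2 / 3)) σ (mi i) (ai i) (bi i)) + s₀)) ∧
      StackWF z (canon (mi i) (L (barlowPos 1 (Real.sqrt (2 / 3)) σ (mi i) (ai i) (bi i)) + s₀)).2)
    (hlines : ∀ i ∈ T, ∀ j ∈ T, i ≠ j → ∀ k ≤ n i,
      barlowPos 1 (Real.sqrt (2 / 3)) σ (mi i) (ai i) (bi i) + ∑ k' ∈ Finset.range k, ms (mi i + k') ≠
        barlowPos 1 (Real.sqrt (2 / 3)) σ (mi j) (ai j) (bi j))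
    (hexit : ∀ i ∈ T, ∀ j ∈ T,
      (L (barlowPos 1 (Real.sqrt (2 / 3)) σ (mi j) (ai j) (bi j)) + s₀) 2 <
        (L (barlowPos 1 (Real.sqrt (2 / 3)) σ (mi i) (ai i) (bi i) + ∑ k' ∈ Finset.range (n i), ms (mi i + k')) + s₀) 2) :
    ∀ i ∈ T, ∀ j ∈ T, i ≠ j → ∀ k,
      walkRun X z k (canon (mi i) (L (barlowPos 1 (Real.sqrt (2 / 3)) σ (mi i) (ai i) (bi i)) + s₀)) ≠
        canon (mi j) (L (barlowPos 1 (Real.sqrt (2 / 3)) σ (mi j) (ai j) (bi j)) + s₀) := by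
  intro i hi j hj hij k hk
  have hpos : ∀ m t, (canon m t).1 = t := by
    intro m t
    rcases hσ (m - 1) with h | h
    · rw [hcanon₁ m t h]
    · rw [hcanon₂ m t h]
  have hpref := fun k' (hk' : k' ≤ n i) =>
    walkRun_canon_prefix σ L s₀ z v₀ canon ms hσ hX₁ hv₀ hv₀2 hcanon₁ hcanon₂ hms₁ hms₂ R hR k' (mi i) (ai i) (bi i)
      (fun k'' hk'' => hin i hi k'' (lt_of_lt_of_le hk'' hk'))
  by_cases hkn : k ≤ n i
  · -- still on the prefix: the positions would coincide
    obtain ⟨h1, -⟩ := hpref k hkn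
    rw [h1] at hk
    have hp := congrArg Prod.fst hk
    rw [hpos, hpos] at hp
    have hp' := L.injective (add_right_cancel hp)
    exact hlines i hi j hj hij k hkn hp'
  · -- beyond the exit site: `e₃`-heights never decrease (tilt toolkit)
    push Not at hkn
    obtain ⟨d, hd⟩ := Nat.exists_eq_add_of_lt hkn
    obtain ⟨h1, -⟩ := hpref (n i) le_rfl
    have hrun : walkRun X z k (canon (mi i) (L (barlowPos 1 (Real.sqrt (2 / 3)) σ (mi i) (ai i) (bi i)) + s₀)) =
        walkRun X z (0 + (d + 1)) (canon (mi i + (n i : ℕ))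
          (L (barlowPos 1 (Real.sqrt (2 / 3)) σ (mi i) (ai i) (bi i) + ∑ k' ∈ Finset.range (n i), ms (mi i + k')) + s₀)) := by
      rw [zero_add, hd, add_assoc, walkRun_add', h1]
    have hvalN := walkRun_valid hX₁ hs₁ hcert hz (n i) (hvalid i hi).1 (hvalid i hi).2
    rw [h1] at hvalN
    have hge := walkRun_height3_mono' hX₁ hs₁ hcert hz hze hvalN.1 0 (d + 1)
    rw [walkRun_zero, ← hrun, hk, hpos, hpos] at hge
    have hlt := hexit i hi j hj
    linarith

/-- **End-injectivity of the family with a tilted vertical** (corollary via `walkRun_injOn_of_orbitFree`). -/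
theorem canon_walkRun_injOn_tilt (hσ : IsHaggSeq σ) (hX₁ : ∀ p ∈ X, ∀ q ∈ X, p ≠ q → 1 ≤ dist p q)
    {s₁ : EuclideanSpace ℝ (Fin 3)} (hs₁ : s₁ ∈ fccSlots) (hcert : ExactOnly 0 (fccSlots.filter fun w => 0 < ⟪w, s₁⟫_ℝ))
    (hz : ‖z‖ = 1) (hze : ‖z - EuclideanSpace.single (2 : Fin 3) (1 : ℝ)‖ ≤ 1 / 4)
    (hv₀ : v₀ ∈ fccSlots) (hv₀2 : v₀ 2 = Real.sqrt (2 / 3))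
    (hcanon₁ : ∀ m t, σ (m - 1) = 1 → canon m t = (t, [⟨L, v₀, 0⟩]))
    (hcanon₂ : ∀ m t, σ (m - 1) = -1 → canon m t =
      (t, [⟨twinFrame L (L (EuclideanSpace.single (2 : Fin 3) (1 : ℝ))),
            bestCapper (twinFrame L (L (EuclideanSpace.single (2 : Fin 3) (1 : ℝ)))) (L (EuclideanSpace.single (2 : Fin 3) (1 : ℝ))) z,
            L (EuclideanSpace.single (2 : Fin 3) (1 : ℝ))⟩, ⟨L, v₀, 0⟩]))
    (hms₁ : ∀ m, σ m = 1 → ms m = v₀)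
    (hms₂ : ∀ m, σ m = -1 → ms m =
      basalMirror (bestCapper (twinFrame L (L (EuclideanSpace.single (2 : Fin 3) (1 : ℝ)))) (L (EuclideanSpace.single (2 : Fin 3) (1 : ℝ))) z))
    (R : Set (EuclideanSpace ℝ (Fin 3)))
    (hR : ∀ m i j : ℤ, barlowPos 1 (Real.sqrt (2 / 3)) σ m i j ∈ R →
      ∀ q ∈ barlowStacking 1 (Real.sqrt (2 / 3)) σ, dist q (barlowPos 1 (Real.sqrt (2 / 3)) σ m i j) ≤ 1 → L q + s₀ ∈ X)
    {ι : Type*} (T : Finset ι) (mi ai bi : ι → ℤ) (n : ι → ℕ)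
    (hin : ∀ i ∈ T, ∀ k < n i,
      barlowPos 1 (Real.sqrt (2 / 3)) σ (mi i) (ai i) (bi i) + ∑ k' ∈ Finset.range k, ms (mi i + k') ∈ R)
    (hvalid : ∀ i ∈ T, WalkInv X z (canon (mi i) (L (barlowPos 1 (Real.sqrt (2 / 3)) σ (mi i) (ai i) (bi i)) + s₀)) ∧
      StackWF z (canon (mi i) (L (barlowPos 1 (Real.sqrt (2 / 3)) σ (mi i) (ai i) (bi i)) + s₀)).2)
    (hlines : ∀ i ∈ T, ∀ j ∈ T, i ≠ j → ∀ k ≤ n i,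
      barlowPos 1 (Real.sqrt (2 / 3)) σ (mi i) (ai i) (bi i) + ∑ k' ∈ Finset.range k, ms (mi i + k') ≠
        barlowPos 1 (Real.sqrt (2 / 3)) σ (mi j) (ai j) (bi j))
    (hexit : ∀ i ∈ T, ∀ j ∈ T,
      (L (barlowPos 1 (Real.sqrt (2 / 3)) σ (mi j) (ai j) (bi j)) + s₀) 2 <
        (L (barlowPos 1 (Real.sqrt (2 / 3)) σ (mi i) (ai i) (bi i) + ∑ k' ∈ Finset.range (n i), ms (mi i + k')) + s₀) 2)
    (N : ℕ) :
    ∀ i ∈ T, ∀ j ∈ T,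
      walkRun X z N (canon (mi i) (L (barlowPos 1 (Real.sqrt (2 / 3)) σ (mi i) (ai i) (bi i)) + s₀)) =
        walkRun X z N (canon (mi j) (L (barlowPos 1 (Real.sqrt (2 / 3)) σ (mi j) (ai j) (bi j)) + s₀)) → i = j :=
  walkRun_injOn_of_orbitFree hX₁ hs₁ hcert hz T
    (fun i => canon (mi i) (L (barlowPos 1 (Real.sqrt (2 / 3)) σ (mi i) (ai i) (bi i)) + s₀)) hvalid
    (canon_orbitFree_tilt σ L s₀ z v₀ canon ms hσ hX₁ hs₁ hcert hz hze hv₀ hv₀2 hcanon₁ hcanon₂ hms₁ hms₂ R hR T mi ai bi n hin hvalid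
      hlines hexit) N

open scoped Classical in
/-- **Window families with a tilted vertical are end-injective over an `e₃`-window.**  See the module docstring. -/
theorem windowFamily_walkRun_injOn_tilt (hσ : IsHaggSeq σ) (hX₁ : ∀ p ∈ X, ∀ q ∈ X, p ≠ q → 1 ≤ dist p q)
    {s₁ : EuclideanSpace ℝ (Fin 3)} (hs₁ : s₁ ∈ fccSlots) (hcert : ExactOnly 0 (fccSlots.filter fun w => 0 < ⟪w, s₁⟫_ℝ))
    (hz : ‖z‖ = 1) (hze : ‖z - EuclideanSpace.single (2 : Fin 3) (1 : ℝ)‖ ≤ 1 / 4)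
    (hv₀ : v₀ ∈ fccSlots) (hv₀2 : v₀ 2 = Real.sqrt (2 / 3))
    (hcanon₁ : ∀ m t, σ (m - 1) = 1 → canon m t = (t, [⟨L, v₀, 0⟩]))
    (hcanon₂ : ∀ m t, σ (m - 1) = -1 → canon m t =
      (t, [⟨twinFrame L (L (EuclideanSpace.single (2 : Fin 3) (1 : ℝ))),
            bestCapper (twinFrame L (L (EuclideanSpace.single (2 : Fin 3) (1 : ℝ)))) (L (EuclideanSpace.single (2 : Fin 3) (1 : ℝ))) z,
            L (EuclideanSpace.single (2 : Fin 3) (1 : ℝ))⟩, ⟨L, v₀, 0⟩]))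
    (hms₁ : ∀ m, σ m = 1 → ms m = v₀)
    (hms₂ : ∀ m, σ m = -1 → ms m =
      basalMirror (bestCapper (twinFrame L (L (EuclideanSpace.single (2 : Fin 3) (1 : ℝ)))) (L (EuclideanSpace.single (2 : Fin 3) (1 : ℝ))) z))
    {δ : ℝ} (hδ0 : 0 < δ) (hδ : ∀ m, δ ≤ ⟪L (ms m), EuclideanSpace.single (2 : Fin 3) (1 : ℝ)⟫_ℝ)
    (R : Set (EuclideanSpace ℝ (Fin 3)))
    (hR : ∀ m i j : ℤ, barlowPos 1 (Real.sqrt (2 / 3)) σ m i j ∈ R →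
      ∀ q ∈ barlowStacking 1 (Real.sqrt (2 / 3)) σ, dist q (barlowPos 1 (Real.sqrt (2 / 3)) σ m i j) ≤ 1 → L q + s₀ ∈ X)
    (H Ztop : ℝ) (hHZ : H + 1 ≤ Ztop)
    {ι : Type*} (T : Finset ι) (mi ai bi : ι → ℤ)
    (hRin : ∀ i ∈ T, ∀ m a b : ℤ,
      H ≤ ⟪L (barlowPos 1 (Real.sqrt (2 / 3)) σ m a b) + s₀, EuclideanSpace.single (2 : Fin 3) (1 : ℝ)⟫_ℝ →
      ⟪L (barlowPos 1 (Real.sqrt (2 / 3)) σ m a b) + s₀, EuclideanSpace.single (2 : Fin 3) (1 : ℝ)⟫_ℝ ≤ Ztop →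
      ‖barlowPos 1 (Real.sqrt (2 / 3)) σ m a b - barlowPos 1 (Real.sqrt (2 / 3)) σ (mi i) (ai i) (bi i)‖ ≤ (Ztop - H) / δ + 1 →
      barlowPos 1 (Real.sqrt (2 / 3)) σ m a b ∈ R)
    (hlow : ∀ i ∈ T, H ≤ ⟪L (barlowPos 1 (Real.sqrt (2 / 3)) σ (mi i) (ai i) (bi i)) + s₀, EuclideanSpace.single (2 : Fin 3) (1 : ℝ)⟫_ℝ)
    (hpred : ∀ i ∈ T, ⟪L (barlowPos 1 (Real.sqrt (2 / 3)) σ (mi i) (ai i) (bi i) - ms (mi i - 1)) + s₀,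
      EuclideanSpace.single (2 : Fin 3) (1 : ℝ)⟫_ℝ < H)
    (hinjT : ∀ i ∈ T, ∀ j ∈ T,
      barlowPos 1 (Real.sqrt (2 / 3)) σ (mi i) (ai i) (bi i) = barlowPos 1 (Real.sqrt (2 / 3)) σ (mi j) (ai j) (bi j) → i = j)
    (hvalid : ∀ i ∈ T, WalkInv X z (canon (mi i) (L (barlowPos 1 (Real.sqrt (2 / 3)) σ (mi i) (ai i) (bi i)) + s₀)) ∧
      StackWF z (canon (mi i) (L (barlowPos 1 (Real.sqrt (2 / 3)) σ (mi i) (ai i) (bi i)) + s₀)).2)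
    (N : ℕ) :
    ∀ i ∈ T, ∀ j ∈ T,
      walkRun X z N (canon (mi i) (L (barlowPos 1 (Real.sqrt (2 / 3)) σ (mi i) (ai i) (bi i)) + s₀)) =
        walkRun X z N (canon (mi j) (L (barlowPos 1 (Real.sqrt (2 / 3)) σ (mi j) (ai j) (bi j)) + s₀)) → i = j := by
  -- notation
  set e₃ : EuclideanSpace ℝ (Fin 3) := EuclideanSpace.single (2 : Fin 3) (1 : ℝ) with he₃
  have he₃n : ‖e₃‖ = 1 := by rw [he₃, PiLp.norm_single, norm_one]
  have he₃i : ∀ d : EuclideanSpace ℝ (Fin 3), ⟪d, e₃⟫_ℝ = d 2 := fun d => by rw [he₃, EuclideanSpace.inner_single_right]; simp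
  set bp : ℤ → ℤ → ℤ → EuclideanSpace ℝ (Fin 3) := fun m a b => barlowPos 1 (Real.sqrt (2 / 3)) σ m a b with hbp
  set site : ι → ℕ → EuclideanSpace ℝ (Fin 3) :=
    fun i k => bp (mi i) (ai i) (bi i) + ∑ k' ∈ Finset.range k, ms (mi i + k') with hsite
  set ht : EuclideanSpace ℝ (Fin 3) → ℝ := fun p => ⟪L p + s₀, e₃⟫_ℝ with hht
  have hms : ∀ m, ‖ms m‖ = 1 := by
    intro m
    rcases hσ m with h | h
    · rw [hms₁ m h, norm_eq_one_of_mem_fccSlots hv₀]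
    · rw [hms₂ m h, LinearIsometryEquiv.norm_map, norm_eq_one_of_mem_fccSlots (bestCapper_nabla_slot L z).1]
  -- heights along the zigzags (in `e₃`)
  have hgrow : ∀ i (k : ℕ), ht (bp (mi i) (ai i) (bi i)) + k * δ ≤ ht (site i k) := fun i k => by
    simp only [hht, hsite]; exact height_site_ge L s₀ e₃ ms hδ _ (mi i) k
  have hsucc : ∀ i (k : ℕ), site i (k + 1) = site i k + ms (mi i + k) := fun i k => by
    simp only [hsite]; rw [Finset.sum_range_succ, add_assoc]
  -- exit indices
  set K₀ : ℕ := ⌈(Ztop - H) / δ⌉₊ + 1 with hK₀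
  have hZH : 0 ≤ (Ztop - H) / δ := div_nonneg (by linarith) hδ0.le
  have hK₀gt : (Ztop - H) / δ < ((K₀ : ℕ) : ℝ) := by
    rw [hK₀]; push_cast; have := Nat.le_ceil ((Ztop - H) / δ); linarith
  have hK₀le : ((K₀ : ℕ) : ℝ) ≤ (Ztop - H) / δ + 2 := by
    rw [hK₀]; push_cast; have := Nat.ceil_lt_add_one hZH; linarith
  have hex : ∀ i ∈ T, ∃ k : ℕ, Ztop < ht (site i k) := by
    intro i hi
    refine ⟨K₀, lt_of_lt_of_le ?_ (hgrow i K₀)⟩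
    have h1 := hlow i hi
    have h2 : Ztop - H < (K₀ : ℝ) * δ := by
      rw [div_lt_iff₀ hδ0] at hK₀gt; linarith
    show Ztop < ht (bp (mi i) (ai i) (bi i)) + K₀ * δ
    simp only [hht] at h1 ⊢; linarith
  set n : ι → ℕ := fun i => if hi : i ∈ T then Nat.find (hex i hi) else 0 with hn
  have hn_spec : ∀ i (hi : i ∈ T), Ztop < ht (site i (n i)) := by
    intro i hi; simp only [hn, dif_pos hi]; exact Nat.find_spec (hex i hi)
  have hn_min : ∀ i (hi : i ∈ T), ∀ k < n i, ht (site i k) ≤ Ztop := by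
    intro i hi k hk
    simp only [hn, dif_pos hi] at hk
    have := Nat.find_min (hex i hi) hk
    push Not at this; exact this
  have hn_le : ∀ i (hi : i ∈ T), n i ≤ K₀ := by
    intro i hi; simp only [hn, dif_pos hi]
    exact Nat.find_le (by
      refine lt_of_lt_of_le ?_ (hgrow i K₀)
      have h1 := hlow i hi
      have h2 : Ztop - H < (K₀ : ℝ) * δ := by rw [div_lt_iff₀ hδ0] at hK₀gt; linarith
      show Ztop < ht (bp (mi i) (ai i) (bi i)) + K₀ * δ
      simp only [hht] at h1 ⊢; linarith)
  -- the three hypotheses of `canon_walkRun_injOn_tilt`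
  have hin : ∀ i ∈ T, ∀ k < n i, site i k ∈ R := by
    intro i hi k hk
    obtain ⟨a, b, hab⟩ := site_mem_barlowLayer σ L z v₀ ms hσ hv₀ hv₀2 hms₁ hms₂ (mi i) (ai i) (bi i) k
    have hab' : site i k = bp (mi i + k) a b := hab
    have f1 : H ≤ ht (site i k) := by
      have h1 := hgrow i k; have h2 := hlow i hi
      have h3 : (0 : ℝ) ≤ k * δ := by positivity
      simp only [hht, hsite, hbp] at h1 h2 ⊢; linarith
    have f2 : ht (site i k) ≤ Ztop := hn_min i hi k hk
    have f3 : ‖site i k - bp (mi i) (ai i) (bi i)‖ ≤ (Ztop - H) / δ + 1 := by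
      have hd : site i k - bp (mi i) (ai i) (bi i) = ∑ k' ∈ Finset.range k, ms (mi i + k') := by simp only [hsite]; abel
      rw [hd]
      calc ‖∑ k' ∈ Finset.range k, ms (mi i + k')‖ ≤ ∑ k' ∈ Finset.range k, ‖ms (mi i + k')‖ := norm_sum_le _ _
        _ = k := by simp [hms]
        _ ≤ (Ztop - H) / δ + 1 := by
            have hk' : (k : ℝ) + 1 ≤ (n i : ℕ) := by exact_mod_cast hk
            have hni : ((n i : ℕ) : ℝ) ≤ K₀ := by exact_mod_cast hn_le i hi
            linarith
    rw [hab'] at f1 f2 f3 ⊢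
    exact hRin i hi (mi i + k) a b f1 f2 f3
  have hexit : ∀ i ∈ T, ∀ j ∈ T, ht (bp (mi j) (ai j) (bi j)) < ht (site i (n i)) := by
    intro i hi j hj
    have h1 := hn_spec i hi
    have h2 : ht (bp (mi j) (ai j) (bi j)) < H + 1 := by
      have h3 := hpred j hj
      have h4 := height_step_le L s₀ e₃ ms he₃n hms (bp (mi j) (ai j) (bi j) - ms (mi j - 1)) (mi j - 1)
      rw [sub_add_cancel] at h4
      simp only [hht]; linarith
    linarith
  have hexit' : ∀ i ∈ T, ∀ j ∈ T, (L (bp (mi j) (ai j) (bi j)) + s₀) 2 < (L (site i (n i)) + s₀) 2 := by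
    intro i hi j hj
    have h := hexit i hi j hj
    simp only [hht] at h
    rwa [he₃i, he₃i] at h
  have hlines : ∀ i ∈ T, ∀ j ∈ T, i ≠ j → ∀ k ≤ n i, site i k ≠ bp (mi j) (ai j) (bi j) := by
    intro i hi j hj hij k hk heq
    rcases Nat.eq_zero_or_pos k with hk0 | hkpos
    · subst hk0
      have : site i 0 = bp (mi i) (ai i) (bi i) := by simp [hsite]
      rw [this] at heq
      exact hij (hinjT i hi j hj heq)
    · -- the predecessor of `p_j` is site `k - 1` of `i`, at height ≥ H
      obtain ⟨k₁, rfl⟩ := Nat.exists_eq_add_of_lt hkpos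
      simp only [zero_add] at heq hk
      obtain ⟨a, b, hab⟩ := site_mem_barlowLayer σ L z v₀ ms hσ hv₀ hv₀2 hms₁ hms₂ (mi i) (ai i) (bi i) (k₁ + 1)
      have hab' : site i (k₁ + 1) = bp (mi i + ((k₁ + 1 : ℕ) : ℤ)) a b := hab
      have hlayer : mi i + ((k₁ + 1 : ℕ) : ℤ) = mi j := by
        rw [hab'] at heq
        exact (barlowPos_injective σ heq).1
      have hpredeq : bp (mi j) (ai j) (bi j) - ms (mi j - 1) = site i k₁ := by
        rw [← heq, hsucc, ← hlayer]
        have e : mi i + ((k₁ + 1 : ℕ) : ℤ) - 1 = mi i + (k₁ : ℤ) := by push_cast; ring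
        rw [e, add_sub_cancel_right]
      have h1 := hpred j hj
      rw [hpredeq] at h1
      have h2 := hgrow i k₁; have h3 := hlow i hi
      have h4 : (0 : ℝ) ≤ k₁ * δ := by positivity
      simp only [hht] at h1 h2 h3
      linarith
  exact canon_walkRun_injOn_tilt σ L s₀ z v₀ canon ms hσ hX₁ hs₁ hcert hz hze hv₀ hv₀2 hcanon₁ hcanon₂ hms₁ hms₂ R hR T mi ai bi n
    hin hvalid hlines hexit' N

end Moved

end Summit.Ventures.Crystal3D.Theorems

end
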